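import Summits.AtomisticToContinuum.FouriersLaw.Theorems.BondHeatUncertaintyBoundedResponseBathHeatA

/-!
# BondHeatUncertainty / BoundedResponse — «BathHeat», part B: §1 the heat-proxy variance identity (abstract Kundu–Dhar–Narayan dictionary)
(lens-1 g107 NODE 107 `…BathHeat.lean` sha256 128247e61f0c3dd6…, 1464 l, cut at section boundaries under the 400-line cap by hand-2 g39 for landing: A = §0 (l.1–266),
B = §1 (l.268–492), C = §2 (l.494–617), D = §3 (l.619–867), E = §4 (l.869–1214), main = §5 (l.1216–1462); bodies byte-verbatim, header l.92–107 repeated; full module docstring in part A.) -/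

noncomputable section

open MeasureTheory ProbabilityTheory Filter Topology Set Function
open scoped NNReal ENNReal
open Literature.MathematicalPhysics.KineticTheory.HeatConduction
open Literature.MathematicalPhysics.KineticTheory OscillatorChain
open Literature.Probability.Process
open Summit.AtomisticToContinuum.FouriersLaw.Theorems.SubdiffusiveBondHeat
open Summit.AtomisticToContinuum.FouriersLaw.Theorems.SubdiffusiveBondHeat.EscapeGrading
open Summit.AtomisticToContinuum.FouriersLaw.Theorems.OddSectorIrreversibility

namespace Summit.AtomisticToContinuum.FouriersLaw.Theorems.BoundedResponse.HeatSpreading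

open Summit.AtomisticToContinuum.FouriersLaw.Theorems.BoundedResponse.TransientContact
open Summit.AtomisticToContinuum.FouriersLaw.Theorems.BoundedResponse.ParityFloor (extensiveBlockEnergyVariance_holds)
open Summit.AtomisticToContinuum.FouriersLaw.Theses.BondHeatUncertainty (BoundedResponse SubdiffusiveBondHeat)

/-! ## §1 The heat-proxy variance identity (abstract Kundu–Dhar–Narayan dictionary, kernel/path level) -/

section HeatProxy

variable {ω₂ lam β γ : ℝ} (hω : 0 < ω₂) (hl : 0 < lam) (hβ : 0 < β) (hγ : 0 < γ) {N : ℕ} (hN : 1 < N)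
  {T : ℝ} (hT : 0 < T)
include hω hl hβ hγ hN hT

omit hω hl hβ hγ hN hT in
/-- Expansion of `∫ (B + (E − E₀))²` into the six path moments. [formal bookkeeping] -/
theorem integral_sq_add_sub_expand {Ω : Type*} [MeasurableSpace Ω] {ν : Measure Ω} {B E E₀ : Ω → ℝ}
    (hBB : Integrable (fun p => B p ^ 2) ν) (hEB : Integrable (fun p => E p * B p) ν)
    (hE₀B : Integrable (fun p => E₀ p * B p) ν) (hEE : Integrable (fun p => E p ^ 2) ν)
    (hE₀E : Integrable (fun p => E₀ p * E p) ν) (hE₀ : Integrable (fun p => E₀ p ^ 2) ν) :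
    ∫ p, (B p + (E p - E₀ p)) ^ 2 ∂ν =
      (∫ p, B p ^ 2 ∂ν) + 2 * (∫ p, E p * B p ∂ν) - 2 * (∫ p, E₀ p * B p ∂ν) + (∫ p, E p ^ 2 ∂ν) -
        2 * (∫ p, E₀ p * E p ∂ν) + ∫ p, E₀ p ^ 2 ∂ν := by
  have h : ∀ p, (B p + (E p - E₀ p)) ^ 2 =
      B p ^ 2 + 2 * (E p * B p) - 2 * (E₀ p * B p) + E p ^ 2 - 2 * (E₀ p * E p) + E₀ p ^ 2 := fun p => by ring
  have i2 : Integrable (fun p => 2 * (E p * B p)) ν := hEB.const_mul 2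
  have i3 : Integrable (fun p => 2 * (E₀ p * B p)) ν := hE₀B.const_mul 2
  have i5 : Integrable (fun p => 2 * (E₀ p * E p)) ν := hE₀E.const_mul 2
  have s12 : Integrable (fun p => B p ^ 2 + 2 * (E p * B p)) ν := hBB.add i2
  have s123 : Integrable (fun p => B p ^ 2 + 2 * (E p * B p) - 2 * (E₀ p * B p)) ν := s12.sub i3
  have s1234 : Integrable (fun p => B p ^ 2 + 2 * (E p * B p) - 2 * (E₀ p * B p) + E p ^ 2) ν := s123.add hEE
  have s12345 : Integrable (fun p => B p ^ 2 + 2 * (E p * B p) - 2 * (E₀ p * B p) + E p ^ 2 - 2 * (E₀ p * E p)) ν :=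
    s1234.sub i5
  rw [integral_congr_ae (Eventually.of_forall h), integral_add s12345 hE₀, integral_sub s1234 i5, integral_add s123 hEE,
    integral_sub s12 i3, integral_add hBB i2, MeasureTheory.integral_const_mul, MeasureTheory.integral_const_mul,
    MeasureTheory.integral_const_mul]

/-- The heat proxy `Q_t = ∫₀ᵗ j(z_s) ds + e(z_t) − e(z_0)` is square integrable on path space (`j, e ∈ L²(μ_T)`, `t ≥ 0`).
[formal bookkeeping] -/
theorem pinnedChain_integrable_heatProxy_sq {j e : PhaseSpace N → ℝ} (hjm : Measurable j) (hem : Measurable e)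
    (hj2 : Integrable (fun y => j y ^ 2) ((pinnedChain ω₂ lam β γ).gibbsMeasure N T))
    (he2 : Integrable (fun y => e y ^ 2) ((pinnedChain ω₂ lam β γ).gibbsMeasure N T)) {t : ℝ} (ht : 0 ≤ t) :
    Integrable (fun p : PhaseSpace N × WienerPair =>
      ((∫ s in (0 : ℝ)..t, j ((pinnedChain ω₂ lam β γ).solMap N T T s p.1 (pairPath p.2))) +
        (e ((pinnedChain ω₂ lam β γ).solMap N T T t p.1 (pairPath p.2)) - e p.1)) ^ 2)
      (((pinnedChain ω₂ lam β γ).gibbsMeasure N T).prod wienerPair) := by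
  haveI := pinnedChain_isProbabilityMeasure_gibbsMeasure hω hl.le hβ.le γ N hT
  have hinv := pinnedChain_hinv_T hω hl hβ hγ hN hT
  have h0 : ∀ (y : PhaseSpace N) (w' : WienerPair), (pinnedChain ω₂ lam β γ).solMap N T T 0 y w' = y :=
    fun y w' => pinnedChain_solMap_of_nonpos N T T y w' le_rfl
  have met := pinnedChain_integrable_sq_solMap_of_invariant hω hl.le hβ.le hγ.le N T T _ hinv he2 t
  have me0 := pinnedChain_integrable_sq_solMap_of_invariant hω hl.le hβ.le hγ.le N T T _ hinv he2 0
  simp only [h0] at me0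
  have iBB : Integrable (fun p : PhaseSpace N × WienerPair =>
      (∫ s in (0 : ℝ)..t, j ((pinnedChain ω₂ lam β γ).solMap N T T s p.1 (pairPath p.2))) ^ 2)
      (((pinnedChain ω₂ lam β γ).gibbsMeasure N T).prod wienerPair) := by
    have h := pinnedChain_integrable_intervalIntegral_mul_of_invariant hω hl.le hβ.le hγ.le N T T _ hinv hjm hjm hj2 hj2 ht
    simpa only [sq] using h
  have ietB := pinnedChain_integrable_mul_intervalIntegral_of_invariant hω hl.le hβ.le hγ.le N T T _ hinv hjm hem hj2 he2 t ht
  have ie0B := pinnedChain_integrable_mul_intervalIntegral_of_invariant hω hl.le hβ.le hγ.le N T T _ hinv hjm hem hj2 he2 0 ht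
  simp only [h0] at ie0B
  have ie0et : Integrable (fun p : PhaseSpace N × WienerPair =>
      e p.1 * e ((pinnedChain ω₂ lam β γ).solMap N T T t p.1 (pairPath p.2)))
      (((pinnedChain ω₂ lam β γ).gibbsMeasure N T).prod wienerPair) := by
    refine (me0.1.add met.1).mono' ((hem.comp measurable_fst).mul
      (hem.comp (pinnedChain_measurable_solMap_pairPath hω hl.le hβ.le hγ.le N T T t))).aestronglyMeasurable
      (Eventually.of_forall fun p => ?_)
    simpa [Real.norm_eq_abs] using abs_mul_le_sq_add_sq _ _
  have hsum : Integrable (fun p : PhaseSpace N × WienerPair =>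
      (∫ s in (0 : ℝ)..t, j ((pinnedChain ω₂ lam β γ).solMap N T T s p.1 (pairPath p.2))) ^ 2 +
        2 * (e ((pinnedChain ω₂ lam β γ).solMap N T T t p.1 (pairPath p.2)) *
          ∫ s in (0 : ℝ)..t, j ((pinnedChain ω₂ lam β γ).solMap N T T s p.1 (pairPath p.2))) -
        2 * (e p.1 * ∫ s in (0 : ℝ)..t, j ((pinnedChain ω₂ lam β γ).solMap N T T s p.1 (pairPath p.2))) +
        e ((pinnedChain ω₂ lam β γ).solMap N T T t p.1 (pairPath p.2)) ^ 2 -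
        2 * (e p.1 * e ((pinnedChain ω₂ lam β γ).solMap N T T t p.1 (pairPath p.2))) + e p.1 ^ 2)
      (((pinnedChain ω₂ lam β γ).gibbsMeasure N T).prod wienerPair) :=
    ((((iBB.add (ietB.const_mul 2)).sub (ie0B.const_mul 2)).add met.1).sub (ie0et.const_mul 2)).add me0.1
  refine hsum.congr (Eventually.of_forall fun p => ?_)
  beta_reduce
  ring

/-- **THE HEAT-PROXY VARIANCE IDENTITY** (abstract Kundu–Dhar–Narayan / Einstein–Helfand dictionary at the kernel/path level).
Let `j` be momentum-ODD, `e` and `φ` momentum-EVEN, all in `L²(μ_T)`, and let `e` satisfy Dynkin's identity for the constructed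
kernels with drift `L e = φ − j` («`e` is a local energy, `j` the current it feeds, `φ` the bath drift»).  Then along the stationary
constructed flow `z_s` started from `μ_T`, for every `t ≥ 0`, the HEAT PROXY `Q_t := ∫₀ᵗ j(z_s) ds + e(z_t) − e(z_0)` has
`E[Q_t²] = 2t·⟪e, j − φ⟫_T − 2 ∫₀ᵗ (t − r) ⟪φ, P_r φ⟫_T dr`.
Proof: expand the square into six path moments; express each through kernel pairings (tree, parts 4b/5 of the bath-bond
programme); remove `⟪j,P e⟫`, `⟪e,P e⟫`, `⟪φ,P e⟫` by the integrated Dynkin identity (`L e = φ − j`) and the parities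
`⟪e,P j⟫ = −⟪j,P e⟫`, `⟪e,P φ⟫ = ⟪φ,P e⟫`, `⟪φ,P j⟫ = −⟪j,P φ⟫` (detailed balance); everything but the two displayed terms cancels.
New as a TREE STATEMENT (the bath-bond line `bathBondReduction_conditional` extracted only a one-sided inequality for `E[(∫j)²]`).
[folklore mechanism: Kundu–Dhar–Narayan, J. Stat. Mech. (2009) L03001, open-system Green–Kubo; typed here] -/
theorem pinnedChain_heatProxy_sq_eq {j e φ : PhaseSpace N → ℝ} (hjm : Measurable j) (hem : Measurable e) (hφm : Measurable φ)
    (hj2 : Integrable (fun y => j y ^ 2) ((pinnedChain ω₂ lam β γ).gibbsMeasure N T))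
    (he2 : Integrable (fun y => e y ^ 2) ((pinnedChain ω₂ lam β γ).gibbsMeasure N T))
    (hφ2 : Integrable (fun y => φ y ^ 2) ((pinnedChain ω₂ lam β γ).gibbsMeasure N T))
    (hjo : ∀ y : PhaseSpace N, j (y.1, -y.2) = -1 * j y) (hee : ∀ y : PhaseSpace N, e (y.1, -y.2) = 1 * e y)
    (hφe : ∀ y : PhaseSpace N, φ (y.1, -y.2) = 1 * φ y)
    (hdyn : ∀ (r : ℝ≥0) (z : PhaseSpace N),
      ∫ y, e y ∂((pinnedChain ω₂ lam β γ).transitionKernel N T T r z) - e z =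
        ∫ s in (0 : ℝ)..(r : ℝ), ∫ y, (φ y - j y) ∂((pinnedChain ω₂ lam β γ).transitionKernel N T T s.toNNReal z))
    {t : ℝ} (ht : 0 ≤ t) :
    ∫ p, ((∫ s in (0 : ℝ)..t, j ((pinnedChain ω₂ lam β γ).solMap N T T s p.1 (pairPath p.2))) +
        (e ((pinnedChain ω₂ lam β γ).solMap N T T t p.1 (pairPath p.2)) - e p.1)) ^ 2
      ∂(((pinnedChain ω₂ lam β γ).gibbsMeasure N T).prod wienerPair) =
      2 * t * spair ω₂ lam β γ T N e (fun y => j y - φ y) -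
        2 * ∫ r in (0 : ℝ)..t, (t - r) * kpair ω₂ lam β γ T N φ φ r := by
  have hN0 : 0 < N := Nat.zero_lt_of_lt hN
  haveI := pinnedChain_isProbabilityMeasure_gibbsMeasure hω hl.le hβ.le γ N hT
  have hinv := pinnedChain_hinv_T hω hl hβ hγ hN hT
  -- the drift `ℓ = φ − j ∈ L²`
  have hℓm : Measurable (fun y => φ y - j y) := hφm.sub hjm
  have hℓ2 : Integrable (fun y => (φ y - j y) ^ 2) ((pinnedChain ω₂ lam β γ).gibbsMeasure N T) := by
    refine ((hφ2.add hj2).const_mul 2).mono' (hℓm.pow_const 2).aestronglyMeasurable (Eventually.of_forall fun y => ?_)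
    rw [Real.norm_eq_abs, abs_of_nonneg (sq_nonneg _)]
    simp only [Pi.add_apply]
    nlinarith [sq_nonneg (φ y + j y)]
  -- the flow at time 0
  have h0 : ∀ (y : PhaseSpace N) (w' : WienerPair), (pinnedChain ω₂ lam β γ).solMap N T T 0 y w' = y :=
    fun y w' => pinnedChain_solMap_of_nonpos N T T y w' le_rfl
  -- (i) `E[B²] = 2∫₀ᵗ(t−r)⟪j,P_r j⟫`
  have mBB : ∫ p, (∫ s in (0 : ℝ)..t, j ((pinnedChain ω₂ lam β γ).solMap N T T s p.1 (pairPath p.2))) ^ 2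
      ∂(((pinnedChain ω₂ lam β γ).gibbsMeasure N T).prod wienerPair) =
      2 * ∫ r in (0 : ℝ)..t, (t - r) * kpair ω₂ lam β γ T N j j r :=
    pinnedChain_integral_sq_intervalIntegral_of_invariant hω hl.le hβ.le hγ.le N T T _ hinv hjm hj2 ht
  -- (ii) `E[e(z_t)²] = E[e(z_0)²] = ∫ e²`
  have met := pinnedChain_integrable_sq_solMap_of_invariant hω hl.le hβ.le hγ.le N T T _ hinv he2 t
  have me0 := pinnedChain_integrable_sq_solMap_of_invariant hω hl.le hβ.le hγ.le N T T _ hinv he2 0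
  simp only [h0] at me0
  -- (iii) `E[e(z_t) B] = ∫₀ᵗ ⟪j, P_{t−s} e⟫ ds = ∫₀ᵗ ⟪j, P_u e⟫ du`
  have metB : ∫ p, e ((pinnedChain ω₂ lam β γ).solMap N T T t p.1 (pairPath p.2)) *
      (∫ s in (0 : ℝ)..t, j ((pinnedChain ω₂ lam β γ).solMap N T T s p.1 (pairPath p.2)))
      ∂(((pinnedChain ω₂ lam β γ).gibbsMeasure N T).prod wienerPair) = ∫ u in (0 : ℝ)..t, kpair ω₂ lam β γ T N j e u := by
    rw [pinnedChain_integral_mul_intervalIntegral_final_of_invariant hω hl.le hβ.le hγ.le N T T _ hinv hjm hem hj2 he2 ht]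
    have h := intervalIntegral.integral_comp_sub_left (fun u : ℝ => kpair ω₂ lam β γ T N j e u) t (a := 0) (b := t)
    simp only [sub_self, sub_zero] at h
    exact h
  -- (iv) `E[e(z_0) B] = ∫₀ᵗ ⟪e, P_s j⟫ ds = −∫₀ᵗ ⟪j, P_s e⟫ ds` (parity)
  have me0B : ∫ p, e p.1 * (∫ s in (0 : ℝ)..t, j ((pinnedChain ω₂ lam β γ).solMap N T T s p.1 (pairPath p.2)))
      ∂(((pinnedChain ω₂ lam β γ).gibbsMeasure N T).prod wienerPair) = -∫ u in (0 : ℝ)..t, kpair ω₂ lam β γ T N j e u := by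
    have h := pinnedChain_integral_mul_intervalIntegral_initial_of_invariant hω hl.le hβ.le hγ.le N T T _ hinv hjm hem hj2 he2 ht
    simp only [h0] at h
    rw [h, ← intervalIntegral.integral_neg]
    refine intervalIntegral.integral_congr fun u _ => ?_
    have hp := kpair_parity hω hl hβ hγ hN hT hem hjm he2 hj2 hee hjo u
    simp only [kpair] at hp ⊢
    rw [hp]
    ring
  -- (v) `E[e(z_0) e(z_t)] = ⟪e, P_t e⟫`
  have me0et : ∫ p, e p.1 * e ((pinnedChain ω₂ lam β γ).solMap N T T t p.1 (pairPath p.2))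
      ∂(((pinnedChain ω₂ lam β γ).gibbsMeasure N T).prod wienerPair) = kpair ω₂ lam β γ T N e e t := by
    have h := pinnedChain_pathCorr_eq_of_nonneg hω hl.le hβ.le hγ.le N T T _ hinv hem hem he2 he2 ht
    simp only [h0] at h
    exact h
  -- integrability of the six path moments
  have iBB : Integrable (fun p : PhaseSpace N × WienerPair =>
      (∫ s in (0 : ℝ)..t, j ((pinnedChain ω₂ lam β γ).solMap N T T s p.1 (pairPath p.2))) ^ 2)
      (((pinnedChain ω₂ lam β γ).gibbsMeasure N T).prod wienerPair) := by
    have h := pinnedChain_integrable_intervalIntegral_mul_of_invariant hω hl.le hβ.le hγ.le N T T _ hinv hjm hjm hj2 hj2 ht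
    simpa only [sq] using h
  have ietB := pinnedChain_integrable_mul_intervalIntegral_of_invariant hω hl.le hβ.le hγ.le N T T _ hinv hjm hem hj2 he2 t ht
  have ie0B := pinnedChain_integrable_mul_intervalIntegral_of_invariant hω hl.le hβ.le hγ.le N T T _ hinv hjm hem hj2 he2 0 ht
  simp only [h0] at ie0B
  have ie0et : Integrable (fun p : PhaseSpace N × WienerPair =>
      e p.1 * e ((pinnedChain ω₂ lam β γ).solMap N T T t p.1 (pairPath p.2)))
      (((pinnedChain ω₂ lam β γ).gibbsMeasure N T).prod wienerPair) := by
    refine (me0.1.add met.1).mono' ((hem.comp measurable_fst).mul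
      (hem.comp (pinnedChain_measurable_solMap_pairPath hω hl.le hβ.le hγ.le N T T t))).aestronglyMeasurable
      (Eventually.of_forall fun p => ?_)
    simpa [Real.norm_eq_abs] using abs_mul_le_sq_add_sq _ _
  -- the three Dynkin consequences, doubly integrated
  have dJ := integral_kpair_eq_of_dynkin hω hl hβ hγ hN hT hjm hem hℓm hj2 he2 hℓ2 hdyn ht
  have dE := kpair_dynkin hω hl hβ hγ hN hT hem hem hℓm he2 he2 hℓ2 hdyn ht
  have dΦ := integral_kpair_eq_of_dynkin hω hl hβ hγ hN hT hφm hem hℓm hφ2 he2 hℓ2 hdyn ht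
  -- split the drift pairings: `⟪f, P(φ − j)⟫ = ⟪f, P φ⟫ − ⟪f, P j⟫`, and the parities
  have sJ : ∀ r, kpair ω₂ lam β γ T N j (fun y => φ y - j y) r = kpair ω₂ lam β γ T N j φ r - kpair ω₂ lam β γ T N j j r :=
    fun r => kpair_sub_right hω hl hβ hγ hN hT hjm hφm hjm hj2 hφ2 hj2 r
  have sE : ∀ r, kpair ω₂ lam β γ T N e (fun y => φ y - j y) r = kpair ω₂ lam β γ T N φ e r + kpair ω₂ lam β γ T N j e r := by
    intro r
    rw [kpair_sub_right hω hl hβ hγ hN hT hem hφm hjm he2 hφ2 hj2 r, kpair_parity hω hl hβ hγ hN hT hem hφm he2 hφ2 hee hφe r,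
      kpair_parity hω hl hβ hγ hN hT hem hjm he2 hj2 hee hjo r]
    ring
  have sΦ : ∀ r, kpair ω₂ lam β γ T N φ (fun y => φ y - j y) r = kpair ω₂ lam β γ T N φ φ r + kpair ω₂ lam β γ T N j φ r := by
    intro r
    rw [kpair_sub_right hω hl hβ hγ hN hT hφm hφm hjm hφ2 hφ2 hj2 r, kpair_parity hω hl hβ hγ hN hT hφm hjm hφ2 hj2 hφe hjo r]
    ring
  -- interval integrability of the pairings that get split
  have iJΦ := intervalIntegrable_kpair hω hl hβ hγ hN hT hjm hφm hj2 hφ2 0 t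
  have iJJ := intervalIntegrable_kpair hω hl hβ hγ hN hT hjm hjm hj2 hj2 0 t
  have iΦE := intervalIntegrable_kpair hω hl hβ hγ hN hT hφm hem hφ2 he2 0 t
  have iJE := intervalIntegrable_kpair hω hl hβ hγ hN hT hjm hem hj2 he2 0 t
  have iΦΦ := intervalIntegrable_kpair hω hl hβ hγ hN hT hφm hφm hφ2 hφ2 0 t
  have hw : ∀ {g : ℝ → ℝ}, IntervalIntegrable g volume 0 t → IntervalIntegrable (fun r => (t - r) * g r) volume 0 t :=
    fun hg => hg.continuousOn_mul (continuousOn_const.sub continuousOn_id)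
  -- (dJ') `∫₀ᵗ ⟪j,P_u e⟫ du = t⟪j,e⟫ + ∫(t−r)⟪j,P_r φ⟫ − ∫(t−r)⟪j,P_r j⟫`
  have dJ' : ∫ u in (0 : ℝ)..t, kpair ω₂ lam β γ T N j e u = t * spair ω₂ lam β γ T N j e +
      ((∫ r in (0 : ℝ)..t, (t - r) * kpair ω₂ lam β γ T N j φ r) - ∫ r in (0 : ℝ)..t, (t - r) * kpair ω₂ lam β γ T N j j r) := by
    rw [dJ, ← intervalIntegral.integral_sub (hw iJΦ) (hw iJJ)]
    congr 1
    refine intervalIntegral.integral_congr fun r _ => ?_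
    simp only [sJ r]
    ring
  -- (dΦ') `∫₀ᵗ ⟪φ,P_u e⟫ du = t⟪φ,e⟫ + ∫(t−r)⟪φ,P_r φ⟫ + ∫(t−r)⟪j,P_r φ⟫`
  have dΦ' : ∫ u in (0 : ℝ)..t, kpair ω₂ lam β γ T N φ e u = t * spair ω₂ lam β γ T N φ e +
      ((∫ r in (0 : ℝ)..t, (t - r) * kpair ω₂ lam β γ T N φ φ r) + ∫ r in (0 : ℝ)..t, (t - r) * kpair ω₂ lam β γ T N j φ r) := by
    rw [dΦ, ← intervalIntegral.integral_add (hw iΦΦ) (hw iJΦ)]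
    congr 1
    refine intervalIntegral.integral_congr fun r _ => ?_
    simp only [sΦ r]
    ring
  -- (dE') `⟪e,P_t e⟫ − ‖e‖² = ∫₀ᵗ ⟪φ,P e⟫ + ∫₀ᵗ ⟪j,P e⟫`
  have dE' : kpair ω₂ lam β γ T N e e t - spair ω₂ lam β γ T N e e =
      (∫ u in (0 : ℝ)..t, kpair ω₂ lam β γ T N φ e u) + ∫ u in (0 : ℝ)..t, kpair ω₂ lam β γ T N j e u := by
    rw [dE, intervalIntegral.integral_congr (fun r _ => by rw [sE r]), intervalIntegral.integral_add iΦE iJE]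
  -- the static pairings: `‖e‖² = ∫ e²`, `⟪e, j − φ⟫ = ⟪j,e⟫ − ⟪φ,e⟫`
  have sEE : spair ω₂ lam β γ T N e e = ∫ y, e y ^ 2 ∂((pinnedChain ω₂ lam β γ).gibbsMeasure N T) := by
    simp only [spair, sq]
  have sEJΦ : spair ω₂ lam β γ T N e (fun y => j y - φ y) = spair ω₂ lam β γ T N j e - spair ω₂ lam β γ T N φ e := by
    simp only [spair]
    rw [← integral_sub (integrable_mul_of_sq N hjm hem hj2 he2) (integrable_mul_of_sq N hφm hem hφ2 he2)]
    refine integral_congr_ae (Eventually.of_forall fun y => ?_)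
    ring
  -- expand the square and substitute
  have hexp := integral_sq_add_sub_expand (ν := ((pinnedChain ω₂ lam β γ).gibbsMeasure N T).prod wienerPair)
    (B := fun p => ∫ s in (0 : ℝ)..t, j ((pinnedChain ω₂ lam β γ).solMap N T T s p.1 (pairPath p.2)))
    (E := fun p => e ((pinnedChain ω₂ lam β γ).solMap N T T t p.1 (pairPath p.2))) (E₀ := fun p => e p.1)
    iBB ietB ie0B met.1 ie0et me0.1
  beta_reduce at hexp
  rw [hexp, mBB, metB, me0B, met.2, me0et, me0.2, sEJΦ, ← sEE]
  linarith [dJ', dΦ', dE']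

end HeatProxy

end Summit.AtomisticToContinuum.FouriersLaw.Theorems.BoundedResponse.HeatSpreading

end
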